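import Summits.CriticalPhenomena.PercolationContinuityZ3.Theorems.SahiMasterFamilyFCombExpansion
import Mathlib.Logic.Equiv.Fintype
import Mathlib.Tactic.Linarith
import HarnessLib

/-!
# Face comb sums as comb sums on a smaller cube (re-indexing a face of `Fin n → Bool` by `Fin m`)

Support file (cell `prim-bnk`, seat bnk-2 gen 20; `--supports stmt-CriticalPhenomena-4575`; memo
`run/shared/lean/prim/prim-l12/FROM-prim-bnk-2-g20-CP-CERTIFICATES.md`, §7(0) / Theorem 4).  No definition, no `sorry`, standard axioms.

`…FCombExpansion` reduces `F_p(A,B;G) ≥ 0` to the nonnegativity of the FACE COMB SUMS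
`Σ_{s : s∧¬d = z} φ(s, s⊕d)`.  Here a face (free coordinates `{i : d i}`, frozen values `z` elsewhere) is re-indexed by `Fin m`,
`m = #{i : d i}` (`faceEmbed`-style map written inline: `y ↦ (i ↦ if d i then y (e⁻¹ i) else z i)` for an enumeration `e`), and the
face comb sum becomes the comb sum `Σ_y combTerm` of the RESTRICTED triple `(A∘emb, B∘emb, G∘emb)` on `Fin m → Bool`
(`face_comb_sum_eq`), to which the comb theorems of `…FCombPeelable` / `…FCombReadOnce` / `…FCombThreshold` apply.

Also: the embedding is monotone (`emb_mono`) and its number of `true` coordinates splits as free part + frozen part (`cnt_emb`), which is what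
the threshold / read-once corollaries (`…FCombFThreshold`, `…FCombFReadOnce`) need.  HONEST FRAMING: plumbing only. [this work]
-/

namespace Summit.CriticalPhenomena.PercolationContinuityZ3.Theorems

namespace SahiFComb

open Finset

variable {n m : ℕ}

/-! ### 1. Re-indexing a face by `Fin m` -/

section Face

variable (d z : Fin n → Bool) (e : Fin m ≃ {i : Fin n // d i = true})

/-- Flipping the free part of a face point is xor with `d`. [folklore] -/
theorem emb_not_eq_xor (y : Fin m → Bool) :
    (fun i => if h : d i = true then (fun j => !y j) (e.symm ⟨i, h⟩) else z i)
      = (fun i => xor ((fun i => if h : d i = true then y (e.symm ⟨i, h⟩) else z i) i) (d i)) := by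
  funext i
  by_cases h : d i = true
  · simp [h]
  · have h' : d i = false := by simpa using h
    simp [h']

/-- The face embedding is injective. [folklore] -/
theorem emb_injective :
    Function.Injective (fun (y : Fin m → Bool) => (fun i => if h : d i = true then y (e.symm ⟨i, h⟩) else z i)) := by
  intro y y' hyy
  funext j
  have := congrFun hyy (e j).1
  have hj : d (e j).1 = true := (e j).2
  simp only [hj, dif_pos] at this
  have he : e.symm ⟨(e j).1, hj⟩ = j := by
    have h2 : (⟨(e j).1, hj⟩ : {i : Fin n // d i = true}) = e j := Subtype.ext rfl
    rw [h2, Equiv.symm_apply_apply]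
  rw [he] at this
  exact this

/-- The fiber `{s : s ∧ ¬d = z}` is the image of the face embedding, provided `z` vanishes on `{d = true}`;
otherwise it is empty. [folklore] -/
theorem fiber_eq_image (hz : ∀ i, d i = true → z i = false) :
    (Finset.univ.filter (fun s : Fin n → Bool => (fun i => s i && !d i) = z))
      = Finset.univ.image (fun (y : Fin m → Bool) => (fun i => if h : d i = true then y (e.symm ⟨i, h⟩) else z i)) := by
  ext s
  simp only [Finset.mem_filter, Finset.mem_univ, true_and, Finset.mem_image]
  constructor
  · intro hs
    refine ⟨fun j => s (e j).1, ?_⟩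
    funext i
    by_cases h : d i = true
    · simp only [h, dif_pos]
      have : (e (e.symm ⟨i, h⟩)).1 = i := by rw [Equiv.apply_symm_apply]
      rw [this]
    · have h' : d i = false := by simpa using h
      have := congrFun hs i
      simp only [h', Bool.not_false, Bool.and_true] at this
      simp [h', this]
  · rintro ⟨y, rfl⟩
    funext i
    by_cases h : d i = true
    · simp [h, hz i h]
    · have h' : d i = false := by simpa using h
      simp [h']

/-- If the frozen values `z` do not vanish on the free coordinates, the fiber is empty. [folklore] -/
theorem fiber_eq_empty (hz : ¬ ∀ i, d i = true → z i = false) :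
    (Finset.univ.filter (fun s : Fin n → Bool => (fun i => s i && !d i) = z)) = ∅ := by
  refine Finset.filter_eq_empty_iff.mpr (fun s _ hs => hz (fun i hi => ?_))
  have := congrFun hs i
  simp only [hi, Bool.not_true, Bool.and_false] at this
  exact this.symm

end Face

/-! ### 2. The face comb sum is a comb sum on `Fin m → Bool` -/

/-- Re-indexing the `ℤ`-valued antipode sum (cast of `sum_antipode`). -/
private theorem sum_antipode_real (f : (Fin m → Bool) → ℝ) :
    ∑ y : Fin m → Bool, f (fun j => !y j) = ∑ y : Fin m → Bool, f y := by
  refine Fintype.sum_equiv ⟨fun y j => !y j, fun y j => !y j, fun y => ?_, fun y => ?_⟩ _ _ (fun y => rfl)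
  · funext j; simp
  · funext j; simp

/-- **Face comb sum = comb sum of the restricted triple.**  With `emb y = (i ↦ if d i then y (e⁻¹ i) else z i)` and `X' = X ∘ emb`, and
`z` vanishing on `{d = true}`:
`Σ_{s : s∧¬d = z} φ(s, s⊕d) = Σ_{y : Fin m → Bool} ([A'B'G' y] − [A'G' y ∧ B'G' ȳ] − [G' y ∧ A'B' ȳ ∧ ¬G' ȳ])`. [this work] -/
theorem face_comb_sum_eq (A B G : (Fin n → Bool) → Bool) (d z : Fin n → Bool) (e : Fin m ≃ {i : Fin n // d i = true})
    (hz : ∀ i, d i = true → z i = false) :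
    (∑ s : Fin n → Bool, (if (fun i => s i && !d i) = z then
        ( (Bool.toNat (A (fun i => xor (s i) (d i)) && B (fun i => xor (s i) (d i)) && G (fun i => xor (s i) (d i))) : ℝ)
          + (Bool.toNat (G s) : ℝ) * (Bool.toNat (A (fun i => xor (s i) (d i)) && B (fun i => xor (s i) (d i)) && G (fun i => xor (s i) (d i))) : ℝ)
          - (Bool.toNat (G s) : ℝ) * (Bool.toNat (A (fun i => xor (s i) (d i)) && B (fun i => xor (s i) (d i))) : ℝ)
          - (Bool.toNat (A s && G s) : ℝ) * (Bool.toNat (B (fun i => xor (s i) (d i)) && G (fun i => xor (s i) (d i))) : ℝ) )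
        else 0))
    = ((∑ y : Fin m → Bool,
        (((Bool.toNat ((A (fun i => if h : d i = true then y (e.symm ⟨i, h⟩) else z i))
            && (B (fun i => if h : d i = true then y (e.symm ⟨i, h⟩) else z i))
            && (G (fun i => if h : d i = true then y (e.symm ⟨i, h⟩) else z i))) : ℕ) : ℤ)
        - ((Bool.toNat ((A (fun i => if h : d i = true then y (e.symm ⟨i, h⟩) else z i))
            && (G (fun i => if h : d i = true then y (e.symm ⟨i, h⟩) else z i))
            && (B (fun i => if h : d i = true then (fun j => !y j) (e.symm ⟨i, h⟩) else z i))
            && (G (fun i => if h : d i = true then (fun j => !y j) (e.symm ⟨i, h⟩) else z i))) : ℕ) : ℤ)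
        - ((Bool.toNat ((G (fun i => if h : d i = true then y (e.symm ⟨i, h⟩) else z i))
            && (A (fun i => if h : d i = true then (fun j => !y j) (e.symm ⟨i, h⟩) else z i))
            && (B (fun i => if h : d i = true then (fun j => !y j) (e.symm ⟨i, h⟩) else z i))
            && !(G (fun i => if h : d i = true then (fun j => !y j) (e.symm ⟨i, h⟩) else z i))) : ℕ) : ℤ)) : ℤ) : ℝ) := by
  rw [← Finset.sum_filter, fiber_eq_image d z e hz, Finset.sum_image (fun y _ y' _ h => emb_injective d z e h)]
  -- rewrite xor with `d` as flipping the free part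
  have hx : ∀ y : Fin m → Bool, (fun i => xor ((fun i => if h : d i = true then y (e.symm ⟨i, h⟩) else z i) i) (d i))
      = (fun i => if h : d i = true then (fun j => !y j) (e.symm ⟨i, h⟩) else z i) := fun y => (emb_not_eq_xor d z e y).symm
  simp only [hx]
  push_cast
  -- the lone `[V(ȳ')]` term: re-index by the antipode of the small cube
  have hV : ∑ y : Fin m → Bool, (Bool.toNat ((A (fun i => if h : d i = true then (fun j => !y j) (e.symm ⟨i, h⟩) else z i))
        && (B (fun i => if h : d i = true then (fun j => !y j) (e.symm ⟨i, h⟩) else z i))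
        && (G (fun i => if h : d i = true then (fun j => !y j) (e.symm ⟨i, h⟩) else z i))) : ℝ)
      = ∑ y : Fin m → Bool, (Bool.toNat ((A (fun i => if h : d i = true then y (e.symm ⟨i, h⟩) else z i))
        && (B (fun i => if h : d i = true then y (e.symm ⟨i, h⟩) else z i))
        && (G (fun i => if h : d i = true then y (e.symm ⟨i, h⟩) else z i))) : ℝ) :=
    sum_antipode_real (fun y => (Bool.toNat ((A (fun i => if h : d i = true then y (e.symm ⟨i, h⟩) else z i))
        && (B (fun i => if h : d i = true then y (e.symm ⟨i, h⟩) else z i))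
        && (G (fun i => if h : d i = true then y (e.symm ⟨i, h⟩) else z i))) : ℝ))
  -- the two summands differ pointwise only by `[V(ȳ')] − [V(y')]`, whose sums agree
  rw [← sub_eq_zero, ← Finset.sum_sub_distrib]
  have hpt : ∀ y : Fin m → Bool,
      ( (Bool.toNat ((A (fun i => if h : d i = true then (fun j => !y j) (e.symm ⟨i, h⟩) else z i))
            && (B (fun i => if h : d i = true then (fun j => !y j) (e.symm ⟨i, h⟩) else z i))
            && (G (fun i => if h : d i = true then (fun j => !y j) (e.symm ⟨i, h⟩) else z i))) : ℝ)
        + (Bool.toNat (G (fun i => if h : d i = true then y (e.symm ⟨i, h⟩) else z i)) : ℝ)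
          * (Bool.toNat ((A (fun i => if h : d i = true then (fun j => !y j) (e.symm ⟨i, h⟩) else z i))
            && (B (fun i => if h : d i = true then (fun j => !y j) (e.symm ⟨i, h⟩) else z i))
            && (G (fun i => if h : d i = true then (fun j => !y j) (e.symm ⟨i, h⟩) else z i))) : ℝ)
        - (Bool.toNat (G (fun i => if h : d i = true then y (e.symm ⟨i, h⟩) else z i)) : ℝ)
          * (Bool.toNat ((A (fun i => if h : d i = true then (fun j => !y j) (e.symm ⟨i, h⟩) else z i))
            && (B (fun i => if h : d i = true then (fun j => !y j) (e.symm ⟨i, h⟩) else z i))) : ℝ)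
        - (Bool.toNat ((A (fun i => if h : d i = true then y (e.symm ⟨i, h⟩) else z i))
            && (G (fun i => if h : d i = true then y (e.symm ⟨i, h⟩) else z i))) : ℝ)
          * (Bool.toNat ((B (fun i => if h : d i = true then (fun j => !y j) (e.symm ⟨i, h⟩) else z i))
            && (G (fun i => if h : d i = true then (fun j => !y j) (e.symm ⟨i, h⟩) else z i))) : ℝ) )
      - ( (Bool.toNat ((A (fun i => if h : d i = true then y (e.symm ⟨i, h⟩) else z i))
            && (B (fun i => if h : d i = true then y (e.symm ⟨i, h⟩) else z i))
            && (G (fun i => if h : d i = true then y (e.symm ⟨i, h⟩) else z i))) : ℝ)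
        - (Bool.toNat ((A (fun i => if h : d i = true then y (e.symm ⟨i, h⟩) else z i))
            && (G (fun i => if h : d i = true then y (e.symm ⟨i, h⟩) else z i))
            && (B (fun i => if h : d i = true then (fun j => !y j) (e.symm ⟨i, h⟩) else z i))
            && (G (fun i => if h : d i = true then (fun j => !y j) (e.symm ⟨i, h⟩) else z i))) : ℝ)
        - (Bool.toNat ((G (fun i => if h : d i = true then y (e.symm ⟨i, h⟩) else z i))
            && (A (fun i => if h : d i = true then (fun j => !y j) (e.symm ⟨i, h⟩) else z i))
            && (B (fun i => if h : d i = true then (fun j => !y j) (e.symm ⟨i, h⟩) else z i))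
            && !(G (fun i => if h : d i = true then (fun j => !y j) (e.symm ⟨i, h⟩) else z i))) : ℝ) )
      = (Bool.toNat ((A (fun i => if h : d i = true then (fun j => !y j) (e.symm ⟨i, h⟩) else z i))
            && (B (fun i => if h : d i = true then (fun j => !y j) (e.symm ⟨i, h⟩) else z i))
            && (G (fun i => if h : d i = true then (fun j => !y j) (e.symm ⟨i, h⟩) else z i))) : ℝ)
        - (Bool.toNat ((A (fun i => if h : d i = true then y (e.symm ⟨i, h⟩) else z i))
            && (B (fun i => if h : d i = true then y (e.symm ⟨i, h⟩) else z i))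
            && (G (fun i => if h : d i = true then y (e.symm ⟨i, h⟩) else z i))) : ℝ) := by
    intro y
    generalize A (fun i => if h : d i = true then y (e.symm ⟨i, h⟩) else z i) = a
    generalize B (fun i => if h : d i = true then y (e.symm ⟨i, h⟩) else z i) = b
    generalize G (fun i => if h : d i = true then y (e.symm ⟨i, h⟩) else z i) = g
    generalize A (fun i => if h : d i = true then (fun j => !y j) (e.symm ⟨i, h⟩) else z i) = a'
    generalize B (fun i => if h : d i = true then (fun j => !y j) (e.symm ⟨i, h⟩) else z i) = b'
    generalize G (fun i => if h : d i = true then (fun j => !y j) (e.symm ⟨i, h⟩) else z i) = g'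
    cases a <;> cases b <;> cases g <;> cases a' <;> cases b' <;> cases g' <;> simp
  rw [Finset.sum_congr rfl (fun y _ => hpt y), Finset.sum_sub_distrib, hV, sub_self]


/-! ### 3. Monotonicity and counting on a face -/


/-- The face embedding is monotone in the free part. [folklore] -/
theorem emb_mono (d z : Fin n → Bool) (e : Fin m ≃ {i : Fin n // d i = true}) {y y' : Fin m → Bool} (h : y ≤ y') :
    (fun i => if h : d i = true then y (e.symm ⟨i, h⟩) else z i) ≤ (fun i => if h : d i = true then y' (e.symm ⟨i, h⟩) else z i) := by
  intro i
  by_cases hd : d i = true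
  · simp only [hd, dif_pos]; exact h _
  · simp [hd]

/-- Counting the `true` coordinates of a face point: free part plus frozen part. [folklore] -/
theorem cnt_emb (d z : Fin n → Bool) (e : Fin m ≃ {i : Fin n // d i = true}) (y : Fin m → Bool) :
    (∑ i, Bool.toNat (if h : d i = true then y (e.symm ⟨i, h⟩) else z i))
      = (∑ j, Bool.toNat (y j)) + ∑ i : {i : Fin n // ¬ d i = true}, Bool.toNat (z i.1) := by
  rw [← Fintype.sum_subtype_add_sum_subtype (fun i : Fin n => d i = true)
    (fun i => Bool.toNat (if h : d i = true then y (e.symm ⟨i, h⟩) else z i))]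
  congr 1
  · have h1 : ∀ i : {i : Fin n // d i = true},
        Bool.toNat (if h : d i.1 = true then y (e.symm ⟨i.1, h⟩) else z i.1) = Bool.toNat (y (e.symm i)) := by
      intro i; rw [dif_pos i.2]
    rw [Finset.sum_congr rfl (fun i _ => h1 i)]
    exact Fintype.sum_equiv e.symm _ _ (fun i => rfl)
  · refine Finset.sum_congr rfl (fun i _ => ?_)
    rw [dif_neg i.2]

end SahiFComb

end Summit.CriticalPhenomena.PercolationContinuityZ3.Theorems
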